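import Literature.InformationTheory.QuantumCodes.ShorCodeFamily
import HarnessLib

/-!
# The majority-vote decoder of Shor's `⟦m², 1, m⟧` code as a computable FUNCTION of the syndrome, with certified radius
# `⌊(m−1)/2⌋` in both sectors, for every `m`

Topic `InformationTheory/QuantumCodes`; namespace `Literature.InformationTheory.QuantumCodes`. LADDER-QEC (cell `qec`),
PARTITION row 08 (decoders as functions; correction radius), item 08.SHORDEC — the Q4 rung's «explicit decoder … as a
FUNCTION with a certified correction radius … theorem for families» for Shor's family (`ShorCodeFamily.lean`: qubits
`Fin m × Fin m`, `Z`-checks `Z_{(i,j)}Z_{(i,j+1)}`, `X`-checks on block pairs).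

PRINTED DECODER (Nielsen–Chuang §10.2, chunk p0510 L3–7, for `m = 3`): a bit flip is located by «comparing the first and
second qubits, and then the second and third» inside its block and undone; a phase flip flips «the sign of the first
block of qubits» and is located by comparing the signs of neighbouring blocks (Exercise 10.5: the observables
`X₁…X₆`, `X₄…X₉`) — in both cases a MAJORITY VOTE over an `m`-fold repetition. This file types that decoder for
general `m` and proves its radius:

* `Rep.decode : (Fin (m−1) → 𝔽₂) → (Fin m → 𝔽₂)` — the 1-D repetition decoder: from the adjacent parities
  `σ_l = u_l + u_{l+1}` form the candidate `Σ_{l<j} σ_l` (`= u_j + u_0`) and complement it iff its weight exceeds `m/2`;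
  `Rep.decode_adjSyn : 2·|u| < m → decode (adjSyn u) = u`.
* `ShorCode.majorityX σ (i,j) := Rep.decode (σ (i,·)) j` — the BIT-FLIP decoder (syndrome `H_Z e`, one repetition
  decoding per block); `majorityX_xSyndrome : |e| ≤ ⌊(m−1)/2⌋ → majorityX (xSyndrome e) = e` (the correction IS the error)
  and `majorityX_correctsUpTo : CorrectsUpTo (code m).xSyndrome (rs H_X) |·| ⌊(m−1)/2⌋`.
* `ShorCode.majorityZ s (i,j) := [j = 0]·Rep.decode s i` — the PHASE-FLIP decoder (syndrome `H_X e` = adjacent BLOCK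
  parities; apply `Z` to the first qubit of every block decoded as odd); `rowSpZ_eq_ker_blockParity` (a `Z`-pattern is a
  product of in-block `ZZ` checks iff every block parity is even — `rank H_Z = m(m−1)` and a dimension count) and
  `majorityZ_correctsUpTo : CorrectsUpTo (code m).zSyndrome (rs H_Z) |·| ⌊(m−1)/2⌋`.
* `majority_radius_optimal` — with `ShorCode.code_radius_optimal`: no pair of sector decoders beats this radius, so the
  majority decoders ATTAIN the optimal radius `⌊(m−1)/2⌋` of the family.

Everything is a computable function of the syndrome (prefix sums, a weight comparison); 0 named facts, no `decide` on data,
no instances/notation; axioms standard. HONEST FRAMING: the textbook decoder, machine-checked for all `m`; no novelty.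

## References
* [NielsenChuang2010] §10.1.1 (majority voting for the repetition code) and §10.2 + Exercise 10.5 (chunks p0509 L9–22,
  p0510 L3–7).
* [Shor1995] (the nine-qubit code and its correction procedure).
* [NguyenEtAl2021] §II (arXiv:2104.01205 chunk p0002 L11: «measuring the stabilizers returns … the location and type of the
  physical errors. These can then be remedied by applying suitable X and/or Z correction operations»).
-/

namespace Literature.InformationTheory.QuantumCodes

open Finset Matrix

/-! ## The 1-D repetition decoder -/

namespace Rep

variable {m : ℕ}

/-- Zero-extension of a finitely indexed word to `ℕ`. (definition) [cite: NielsenChuang2010, §10.1.1 (the repetition code)] -/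
def ext0 {n : ℕ} (f : Fin n → ZMod 2) (l : ℕ) : ZMod 2 := if h : l < n then f ⟨l, h⟩ else 0

/-- The **adjacent-parity syndrome** of a repetition-code word `u`: `σ_l = u_l + u_{l+1}`, `l < m − 1` (the values of the
checks `Z_l Z_{l+1}` — «comparing the first and second qubits, and then the second and third»). (definition)
[cite: NielsenChuang2010, §10.2 (chunk p0510 L3)] -/
def adjSyn (u : Fin m → ZMod 2) : Fin (m - 1) → ZMod 2 :=
  fun l => u ⟨l.val, by have := l.isLt; omega⟩ + u ⟨l.val + 1, by have := l.isLt; omega⟩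

/-- The **candidate** reconstructed from a syndrome: `cand σ j = Σ_{l<j} σ_l` (the word with the given adjacent parities
and first letter `0`). (definition) [cite: NielsenChuang2010, §10.1.1 (majority voting)] -/
def cand (σ : Fin (m - 1) → ZMod 2) : Fin m → ZMod 2 := fun j => ∑ l ∈ range j.val, ext0 σ l

/-- The **majority decoder** of the repetition code: the candidate, complemented iff its weight exceeds `m/2` (of the two
words with the observed parities, the lighter one). Computable. (definition)
[cite: NielsenChuang2010, §10.1.1 («majority voting»)] -/
def decode (σ : Fin (m - 1) → ZMod 2) : Fin m → ZMod 2 :=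
  if m < 2 * hammingNorm (cand σ) then cand σ + 1 else cand σ

/-- The candidate of a true syndrome is the word up to a global flip by its first letter: `cand (adjSyn u) j = u_j + u_0`
(telescoping). [cite: NielsenChuang2010, §10.1.1] -/
theorem cand_adjSyn (u : Fin m → ZMod 2) (j : Fin m) :
    cand (adjSyn u) j = u j + u ⟨0, by have := j.isLt; omega⟩ := by
  have hj := j.isLt
  unfold cand
  have hterm : ∀ l ∈ range j.val, ext0 (adjSyn u) l = ext0 u l - ext0 u (l + 1) := by
    intro l hl
    rw [mem_range] at hl
    have h1 : l < m - 1 := by omega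
    have h2 : l < m := by omega
    have h3 : l + 1 < m := by omega
    simp only [ext0, dif_pos h1, dif_pos h2, dif_pos h3, adjSyn]
    rw [CharTwo.sub_eq_add]
  rw [sum_congr rfl hterm, sum_range_sub']
  have h0 : ext0 u 0 = u ⟨0, by omega⟩ := by simp [ext0, show 0 < m by omega]
  have hjj : ext0 u j.val = u j := by simp [ext0, hj]
  rw [h0, hjj, sub_eq_iff_eq_add, add_comm (u j), add_assoc, CharTwo.add_self_eq_zero, add_zero]

/-- Weight of a complement: `|u + 1| + |u| = m`. [cite: NielsenChuang2010, §10.1.1] -/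
theorem hammingNorm_add_one (u : Fin m → ZMod 2) : hammingNorm (u + 1) + hammingNorm u = m := by
  unfold hammingNorm
  have hflip : ∀ a : ZMod 2, a + 1 ≠ 0 ↔ ¬ a ≠ 0 := by decide
  have h1 : (univ.filter fun j => (u + 1) j ≠ 0) = univ.filter (fun j => ¬ (u j ≠ 0)) :=
    filter_congr fun j _ => by simp only [Pi.add_apply, Pi.one_apply]; exact hflip (u j)
  rw [h1, add_comm, Finset.card_filter_add_card_filter_not, card_univ, Fintype.card_fin]

/-- **The repetition decoder recovers every word of weight `< m/2` from its adjacent parities.**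
[cite: NielsenChuang2010, §10.1.1 («provided only one … qubit was flipped, majority voting succeeds»)] -/
theorem decode_adjSyn {u : Fin m → ZMod 2} (hu : 2 * hammingNorm u < m) : decode (adjSyn u) = u := by
  have hm : 0 < m := by omega
  unfold decode
  by_cases h0 : u ⟨0, hm⟩ = 0
  · have hc : cand (adjSyn u) = u := by
      funext j; rw [cand_adjSyn, h0, add_zero]
    rw [hc, if_neg (by omega)]
  · have h1 : u ⟨0, hm⟩ = 1 := by
      have : ∀ a : ZMod 2, a ≠ 0 → a = 1 := by decide
      exact this _ h0
    have hc : cand (adjSyn u) = u + 1 := by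
      funext j; rw [cand_adjSyn, h1]; rfl
    have hw := hammingNorm_add_one u
    rw [hc, if_pos (by omega)]
    funext j
    simp only [Pi.add_apply, Pi.one_apply]
    rw [add_assoc, CharTwo.add_self_eq_zero, add_zero]

end Rep

/-! ## Shor's code: the two majority decoders -/

namespace ShorCode

open RotatedSurface (sum_mul_pair_indicator)

variable {m : ℕ}

/-! ### Bit flips (`X`-errors, syndrome `H_Z e`): one repetition decoding per block -/

/-- **The bit-flip majority decoder** of Shor's `m × m` code: in each block, repetition-decode the in-block parities.
Computable function of the syndrome. (definition) [cite: NielsenChuang2010, §10.2 (chunk p0510 L3: «we conclude that the first qubit flipped, and fix it»)] -/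
def majorityX : Decoder (Fin m × Fin (m - 1) → ZMod 2) (Fin m × Fin m → ZMod 2) :=
  fun σ q => Rep.decode (fun l => σ (q.1, l)) q.2

/-- The `X`-syndrome of Shor's code, block by block, IS the adjacent-parity syndrome of the block's error word.
[cite: NielsenChuang2010, §10.2 (chunk p0510 L3: comparing Z₁Z₂, Z₂Z₃)] -/
theorem xSyndrome_block (e : Fin m × Fin m → ZMod 2) (i : Fin m) :
    (fun l => (code m).xSyndrome e (i, l)) = Rep.adjSyn (fun j => e (i, j)) := by
  funext l
  unfold CSSCode.xSyndrome
  rw [code_HZ]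
  simp only [mulVec, dotProduct, HZ_apply, Rep.adjSyn]
  rw [Fintype.sum_prod_type]
  have hl : l.val + 1 < m := by have := l.isLt; omega
  have hin : ∀ a : Fin m, ∑ b : Fin m,
      (if a = i then (if b.val = l.val ∨ b.val = l.val + 1 then (1 : ZMod 2) else 0) else 0) * e (a, b)
      = if a = i then ∑ b : Fin m, e (i, b) * (if b.val = l.val ∨ b.val = l.val + 1 then 1 else 0) else 0 := by
    intro a
    by_cases ha : a = i
    · subst ha
      simp only [if_true]
      exact sum_congr rfl fun b _ => by split_ifs <;> simp
    · simp only [ha, if_false, zero_mul, sum_const_zero]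
  simp_rw [hin]
  rw [sum_ite_eq' univ i]
  simp only [mem_univ, if_true]
  rw [sum_mul_pair_indicator _ l.val hl]

/-- A block of the error weighs at most the whole error. [cite: NielsenChuang2010, §10.2] -/
theorem hammingNorm_block_le (e : Fin m × Fin m → ZMod 2) (i : Fin m) :
    hammingNorm (fun j => e (i, j)) ≤ hammingNorm e := by
  unfold hammingNorm
  calc (univ.filter fun j => e (i, j) ≠ 0).card
      = ((univ.filter fun j => e (i, j) ≠ 0).map ⟨fun j => (i, j), fun a b h => (Prod.ext_iff.1 h).2⟩).card :=
        (card_map _).symm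
    _ ≤ (univ.filter fun q : Fin m × Fin m => e q ≠ 0).card := by
        refine card_le_card fun q hq => ?_
        rw [mem_map] at hq
        obtain ⟨j, hj, rfl⟩ := hq
        rw [mem_filter] at hj ⊢
        exact ⟨mem_univ _, hj.2⟩

/-- **Route I: on every `X`-pattern of weight `≤ ⌊(m−1)/2⌋` the bit-flip majority decoder returns THE ERROR ITSELF.**
[cite: NielsenChuang2010, §10.2 (chunk p0510 L3)] -/
theorem majorityX_xSyndrome {e : Fin m × Fin m → ZMod 2} (he : hammingNorm e ≤ (m - 1) / 2) :
    majorityX ((code m).xSyndrome e) = e := by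
  funext q
  obtain ⟨i, j⟩ := q
  unfold majorityX
  simp only
  rw [show (fun l => (code m).xSyndrome e (i, l)) = Rep.adjSyn (fun j => e (i, j)) from xSyndrome_block e i,
    Rep.decode_adjSyn]
  have h1 := hammingNorm_block_le e i
  have : 0 < m := by have := j.isLt; omega
  omega

/-- **The bit-flip majority decoder corrects every `X`-pattern of weight `≤ ⌊(m−1)/2⌋`** (as a `Decoder` for the
`X`-sector of `ShorCode.code m`). [cite: NielsenChuang2010, §10.2 (chunk p0510 L3)] -/
theorem majorityX_correctsUpTo (m : ℕ) :
    (majorityX (m := m)).CorrectsUpTo (code m).xSyndrome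
      ((code m).rowSpX : Set (Fin m × Fin m → ZMod 2)) hammingNorm ((m - 1) / 2) := by
  intro e he
  show majorityX ((code m).xSyndrome e) + e ∈ ((code m).rowSpX : Set (Fin m × Fin m → ZMod 2))
  rw [majorityX_xSyndrome he]
  have : e + e = 0 := by funext q; exact CharTwo.add_self_eq_zero _
  rw [this]
  exact (code m).rowSpX.zero_mem

/-! ### Phase flips (`Z`-errors, syndrome `H_X e`): repetition decoding of the block parities -/

/-- The **block-parity map** `π(e)_i = Σ_j e_{(i,j)}` (the sign flip of block `i`). (definition)
[cite: NielsenChuang2010, §10.2 (chunk p0510 L5: «such a phase flip flips the sign of the first block of qubits»)] -/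
def blockParity (m : ℕ) : (Fin m × Fin m → ZMod 2) →ₗ[ZMod 2] (Fin m → ZMod 2) where
  toFun e i := ∑ j, e (i, j)
  map_add' e e' := by funext i; simp [sum_add_distrib]
  map_smul' c e := by funext i; simp [mul_sum]

/-- `blockParity m e i = Σ_j e (i, j)`. [cite: NielsenChuang2010, §10.2 (chunk p0510 L5)] -/
@[simp] theorem blockParity_apply (e : Fin m × Fin m → ZMod 2) (i : Fin m) : blockParity m e i = ∑ j, e (i, j) := rfl

/-- The `Z`-syndrome of Shor's code IS the adjacent-parity syndrome of the block-parity word («comparing the sign» of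
neighbouring blocks). [cite: NielsenChuang2010, §10.2 Exercise 10.5 (chunk p0510 L7)] -/
theorem zSyndrome_eq (e : Fin m × Fin m → ZMod 2) : (code m).zSyndrome e = Rep.adjSyn (blockParity m e) := by
  funext l
  unfold CSSCode.zSyndrome
  rw [code_HX]
  simp only [mulVec, dotProduct, HX_apply, Rep.adjSyn, blockParity_apply]
  rw [Fintype.sum_prod_type]
  have hl : l.val + 1 < m := by have := l.isLt; omega
  have hin : ∀ a : Fin m, ∑ b : Fin m, (if a.val = l.val ∨ a.val = l.val + 1 then (1 : ZMod 2) else 0) * e (a, b)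
      = (∑ b : Fin m, e (a, b)) * (if a.val = l.val ∨ a.val = l.val + 1 then 1 else 0) := by
    intro a
    rw [sum_mul]
    exact sum_congr rfl fun b _ => mul_comm _ _
  simp_rw [hin]
  rw [sum_mul_pair_indicator (fun a : Fin m => ∑ b : Fin m, e (a, b)) l.val hl]

/-- The block-parity word weighs at most the error (every odd block holds an error). [cite: NielsenChuang2010, §10.2] -/
theorem hammingNorm_blockParity_le (e : Fin m × Fin m → ZMod 2) : hammingNorm (blockParity m e) ≤ hammingNorm e := by
  classical
  unfold hammingNorm
  have hsub : (univ.filter fun i => blockParity m e i ≠ 0) ⊆ (univ.filter fun q : Fin m × Fin m => e q ≠ 0).image Prod.fst := by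
    intro i hi
    rw [mem_filter] at hi
    rw [mem_image]
    by_contra hne
    push Not at hne
    apply hi.2
    rw [blockParity_apply]
    refine sum_eq_zero fun j _ => ?_
    by_contra hj
    exact hne (i, j) (mem_filter.2 ⟨mem_univ _, hj⟩) rfl
  exact (card_le_card hsub).trans card_image_le

/-- **The phase-flip majority decoder** of Shor's `m × m` code: repetition-decode the block parities and apply `Z` to the
first qubit of every block decoded as odd. Computable function of the syndrome. (definition)
[cite: NielsenChuang2010, §10.2 (chunk p0510 L5: «we would flip the sign … to recover»)] -/
def majorityZ : Decoder (Fin (m - 1) → ZMod 2) (Fin m × Fin m → ZMod 2) :=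
  fun s q => if q.2.val = 0 then Rep.decode s q.1 else 0

/-- The correction's block parities are the decoded parities. [cite: NielsenChuang2010, §10.2 (chunk p0510 L5)] -/
theorem blockParity_majorityZ (hm : 0 < m) (s : Fin (m - 1) → ZMod 2) : blockParity m (majorityZ s) = Rep.decode s := by
  funext i
  rw [blockParity_apply]
  simp only [majorityZ]
  rw [Finset.sum_eq_single (⟨0, hm⟩ : Fin m)]
  · simp
  · intro b _ hb
    have : b.val ≠ 0 := fun h => hb (Fin.ext h)
    simp [this]
  · intro h; exact absurd (mem_univ _) h

/-- Every in-block `ZZ` check has even parity in every block: `rs H_Z ≤ ker π`. [cite: NielsenChuang2010, §10.2 (chunk p0510 L3)] -/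
theorem rowSpZ_le_ker_blockParity (m : ℕ) : (code m).rowSpZ ≤ LinearMap.ker (blockParity m) := by
  have h1 : (code m).rowSpZ = Submodule.span (ZMod 2) (Set.range (HZ m).row) := range_vecMulLinear (HZ m)
  rw [h1, Submodule.span_le]
  rintro _ ⟨z, rfl⟩
  rw [SetLike.mem_coe, LinearMap.mem_ker]
  funext i
  rw [blockParity_apply, Pi.zero_apply]
  simp only [Matrix.row_apply, HZ_apply]
  have hz : z.2.val + 1 < m := by have := z.2.isLt; omega
  by_cases hi : i = z.1
  · have e1 : ∀ b : Fin m, (if i = z.1 then (if b.val = z.2.val ∨ b.val = z.2.val + 1 then (1 : ZMod 2) else 0) else 0)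
        = (1 : ZMod 2) * (if b.val = z.2.val ∨ b.val = z.2.val + 1 then 1 else 0) := fun b => by
      rw [if_pos hi, one_mul]
    simp_rw [e1]
    rw [sum_mul_pair_indicator (fun _ : Fin m => (1 : ZMod 2)) z.2.val hz]
    exact CharTwo.add_self_eq_zero (1 : ZMod 2)
  · have e1 : ∀ b : Fin m, (if i = z.1 then (if b.val = z.2.val ∨ b.val = z.2.val + 1 then (1 : ZMod 2) else 0) else 0)
        = 0 := fun b => by rw [if_neg hi]
    simp_rw [e1]
    exact sum_const_zero

/-- **A `Z`-pattern is a product of in-block `ZZ` checks iff every block parity is even**: `rs H_Z = ker π`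
(dimension count: `rank H_Z = m(m−1)` and `π` is onto `𝔽₂^m`). [cite: NielsenChuang2010, §10.2 (chunk p0510 L3–5)] -/
theorem rowSpZ_eq_ker_blockParity (m : ℕ) : (code m).rowSpZ = LinearMap.ker (blockParity m) := by
  refine Submodule.eq_of_le_of_finrank_le (rowSpZ_le_ker_blockParity m) ?_
  -- `dim ker π = m² − m`
  have hsurj : LinearMap.range (blockParity m) = ⊤ := by
    rw [LinearMap.range_eq_top]
    intro w
    refine ⟨fun q => if q.2.val = 0 then w q.1 else 0, ?_⟩
    funext i
    rw [blockParity_apply]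
    rcases Nat.eq_zero_or_pos m with h0 | hm
    · exact absurd i.isLt (by omega)
    rw [Finset.sum_eq_single (⟨0, hm⟩ : Fin m)]
    · simp
    · intro b _ hb
      have : b.val ≠ 0 := fun h => hb (Fin.ext h)
      simp [this]
    · intro h; exact absurd (mem_univ _) h
  have hrn := LinearMap.finrank_range_add_finrank_ker (blockParity m)
  rw [hsurj, finrank_top, Module.finrank_fintype_fun_eq_card, Module.finrank_fintype_fun_eq_card, Fintype.card_fin,
    Fintype.card_prod, Fintype.card_fin] at hrn
  have hrs : Module.finrank (ZMod 2) (code m).rowSpZ = m * (m - 1) := by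
    rw [show (code m).rowSpZ = rowSpace (HZ m) from rfl, finrank_rowSpace_eq_rank, rank_HZ]
  rw [hrs]
  have : m * (m - 1) + m = m * m := by
    rcases Nat.eq_zero_or_pos m with h0 | hm
    · subst h0; simp
    · have h1 : m - 1 + 1 = m := by omega
      rw [← mul_add_one, h1]
  omega

/-- **The phase-flip majority decoder corrects every `Z`-pattern of weight `≤ ⌊(m−1)/2⌋`** (as a `Decoder` for the
`Z`-sector of `ShorCode.code m`): the decoded block parities are the true ones, so the net `Z`-pattern has even parity in
every block and is a product of `ZZ` checks. [cite: NielsenChuang2010, §10.2 (chunk p0510 L5–7)] -/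
theorem majorityZ_correctsUpTo (m : ℕ) :
    (majorityZ (m := m)).CorrectsUpTo (code m).zSyndrome
      ((code m).rowSpZ : Set (Fin m × Fin m → ZMod 2)) hammingNorm ((m - 1) / 2) := by
  intro e he
  show majorityZ ((code m).zSyndrome e) + e ∈ ((code m).rowSpZ : Set (Fin m × Fin m → ZMod 2))
  rcases Nat.eq_zero_or_pos m with h0 | hm
  · -- no qubits: every vector is `0`
    subst h0
    have : majorityZ ((code 0).zSyndrome e) + e = 0 := by funext q; exact absurd q.1.isLt (by omega)
    rw [this]; exact (code 0).rowSpZ.zero_mem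
  rw [SetLike.mem_coe, rowSpZ_eq_ker_blockParity, LinearMap.mem_ker, map_add, zSyndrome_eq,
    blockParity_majorityZ hm, Rep.decode_adjSyn]
  · funext i; exact CharTwo.add_self_eq_zero _
  · have := hammingNorm_blockParity_le e
    omega

/-! ### The pair attains the optimal radius -/

/-- **The majority decoders attain the optimal radius of Shor's family**: they correct every `X`- and every `Z`-pattern of
weight `≤ ⌊(m−1)/2⌋`, and no pair of sector decoders corrects all patterns of a larger weight (`code_radius_optimal`).
[cite: NielsenChuang2010, §10.2 (chunk p0509 L11)] [cite: NguyenEtAl2021, §II (chunk p0002 L11)] -/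
theorem majority_radius_optimal (hm : 0 < m) :
    ((majorityX (m := m)).CorrectsUpTo (code m).xSyndrome ((code m).rowSpX : Set (Fin m × Fin m → ZMod 2))
        hammingNorm ((m - 1) / 2) ∧
      (majorityZ (m := m)).CorrectsUpTo (code m).zSyndrome ((code m).rowSpZ : Set (Fin m × Fin m → ZMod 2))
        hammingNorm ((m - 1) / 2)) ∧
    ∀ t : ℕ, (majorityX (m := m)).CorrectsUpTo (code m).xSyndrome
        ((code m).rowSpX : Set (Fin m × Fin m → ZMod 2)) hammingNorm t →
      (majorityZ (m := m)).CorrectsUpTo (code m).zSyndrome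
        ((code m).rowSpZ : Set (Fin m × Fin m → ZMod 2)) hammingNorm t → t ≤ (m - 1) / 2 :=
  ⟨⟨majorityX_correctsUpTo m, majorityZ_correctsUpTo m⟩, fun _ hX hZ => code_radius_optimal hm hX hZ⟩

/-! ### Degeneracy: the phase-flip decoder works far beyond the radius (appended 2026-08-27, qec-type-08 gen 5) -/

/-- **Degenerate decoding beyond the radius.** The phase-flip majority decoder corrects EVERY `Z`-pattern with fewer than
`m/2` odd-parity blocks — whatever its weight (e.g. any number of `Z`-errors spread evenly, two per block): Shor's code is
degenerate (`Z_{(i,j)}Z_{(i,j')}` is a stabilizer), and only the block parities matter to this decoder. This is the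
mechanism behind the family's high tolerance to phase noise («the Shor code … has a memory threshold of 50% for Z errors»).
[cite: NguyenEtAl2021, §I (arXiv:2104.01205 chunk p0002 L1: «memory threshold of 50% for Z errors»)] [cite: NielsenChuang2010, §10.2 (chunk p0510 L5)] -/
theorem majorityZ_corrects_of_blockParity (hm : 0 < m) {e : Fin m × Fin m → ZMod 2}
    (he : 2 * hammingNorm (blockParity m e) < m) :
    (majorityZ (m := m)).Corrects (code m).zSyndrome ((code m).rowSpZ : Set (Fin m × Fin m → ZMod 2)) e := by
  show majorityZ ((code m).zSyndrome e) + e ∈ ((code m).rowSpZ : Set (Fin m × Fin m → ZMod 2))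
  rw [SetLike.mem_coe, rowSpZ_eq_ker_blockParity, LinearMap.mem_ker, map_add, zSyndrome_eq,
    blockParity_majorityZ hm, Rep.decode_adjSyn he]
  funext i
  exact CharTwo.add_self_eq_zero _

/-- In particular every `Z`-pattern with EVEN parity in every block (any weight) is corrected — indeed it is a stabilizer.
[cite: NielsenChuang2010, §10.2 (chunk p0510 L3–5)] -/
theorem majorityZ_corrects_of_blockParity_eq_zero (hm : 0 < m) {e : Fin m × Fin m → ZMod 2}
    (he : blockParity m e = 0) :
    (majorityZ (m := m)).Corrects (code m).zSyndrome ((code m).rowSpZ : Set (Fin m × Fin m → ZMod 2)) e :=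
  majorityZ_corrects_of_blockParity hm (by rw [he]; simp; exact hm)

end ShorCode

end Literature.InformationTheory.QuantumCodes
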